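/-
COR-CM (cell pub-hodgecm2) — Δ2 BRIDGE, THE `μ ↦ μᶜ` IDENTIFICATION LEMMA (audit seat pub-hodgeaudit-ident-1, checker ident-2; coordinator 2026-08-24T03:08:57Z
«make this an ordinary citation»).  NEW FILE, THEOREMS ONLY: no `def`, no instance, no named-fact hypothesis, no `sorry`; nothing landed is edited.
HC_CM is NOT proved; «Δ2 BRIDGE CLOSED» is NOT claimed; the row `hLiuC` stays a READING (r8) at the orientation bit = the CITED CONVENTION `D_BMM`.
-/
import Summits.HodgeConjecture.CorCM.D2Bridge.AdapterMuConj
import Summits.HodgeConjecture.CorCM.B01.Transposition.Item6UniformOmegaRep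
import Summits.HodgeConjecture.CorCM.B01.Transposition.HComp.Sec42DataOf
import Summits.HodgeConjecture.CorCM.PortJoin.HMDischargeLocal
import Summits.HodgeConjecture.CorCM.D2Bridge.OmegaPinAtLiuIndexOfRecord
import Summits.HodgeConjecture.CorCM.D2Bridge.OmegaAtDeltaPrime
import Literature.NumberTheory.Automorphic.Liu2021.AppendixC.Prop413DataOfRestOne
import Literature.NumberTheory.Automorphic.IdeleClassCharacterConjugate
import Literature.AlgebraicGeometry.Liu2021.AdmissibleElement
import HarnessLib

set_option autoImplicit false

/-!
# The `μ ↦ μᶜ` identification lemma: the datum of `hLiuC` IS [Liu2021, Thm. 4.18]'s datum at `(X(𝕍^{(c)}), ν)`, component by component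

[Liu2021] = Y. Liu, *Fourier–Jacobi cycles and arithmetic relative trace formula*, Camb. J. Math. **9** (2021) = arXiv:2102.11518 (`FJcycle.tex`).

THE ROW.  The END of record (✔ `D2Bridge/ClosedPrintedMuConj.lean` = p374084, :273–:277; the HomNeZero ∕ MuKey editions carry the same text, MuKey
scalar-keyed) displays [Liu2021, Thm. 4.18] AS PRINTED at `D := toThm418Data ℭ ((AdapterMuConj.muConj 𝕌).rest (restTailOne (AlgHom.id ℚ F) ι₁ hν hw
(Def45.Carriers.ofPolDR ν (Def45.PolDR ι₁ hν (Def45.RMuForm ι₁ hν))) (𝕋.rhoΩOne …)))` for every conjugate-symplectic weight-one `ν` (`ℭ := sec42DataOf …` the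
§4.2 datum of record, `𝕌` the line's μ-uniform Def. 4.11 carriers `uniformOmegaRep …`, `𝕋` the Hecke translates).  Under the cited Hodge-type sign convention
([BMM16] §5; Literature `D_BMM`, seat bmmdef-1 — the ORIENTATION BIT, displayed by the END as `(hBMM : D_BMM)`, consumed by no proof) `ℭ.X = M^{(c)}` is Liu's
`X(𝕍^{(c)})` and Thm. 4.18 for `(𝕍^{(c)}, ν)` reads VERBATIM `Hom_F(Alb(M^{(c)}_K), A_ν)_ℚ ⊗ ℂ ≅ ⊕_{ε′ ν-adm, χ′} ω_{V^{(c)}}(ν, ε′, χ′)` with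
`ω_{V^{(c)}}(ν, ε′, χ′) = ω_V(νᶜ, −ε′, χ′⁻¹)` and «`ε′` is `ν`-admissible iff `−ε′` is `νᶜ`-admissible» (Def. 4.12, last sentence) — d2bridge-stmt g3
(cm2 INBOX l.12698), cite-1 DELTA 92 ∕ 98 ∕ 108a, d2bridge-ref G35 §0 ∕ G45 §1 ∕ G47.

WHAT THIS FILE PROVES (kernel, unconditional; every proof `rfl` ∕ `Iff.rfl` ∕ a re-indexing; no row of any END is consumed):
§1 GENERIC — for ANY App-C datum `C`, `U : UniformOmega C`, conjugate-symplectic weight-one `ν`, presentation `(φ, ι)` of `M′_ν`, Def. 4.5 carriers `Car` and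
   Hecke action `rhoΩ`, the components of `D := toThm418Data C ((muConj U).rest (restTailOne φ ι hν hw Car rhoΩ))` in `Thm418Data`'s field names: `D.G = C.G`;
   `D.μ = ν` (REAL), `D.cmType = Φ_ν = Φ̄_{νᶜ}` (Rem. 4.4); (i) blocks `D.omega ε χ = U.omega νᶜ _ ε χ`, `D.rho … = U.rho νᶜ …` — the line's blocks at the label `νᶜ`
   (✔ `AdapterMuConj.muConj_omega`; WHICH printed block of `𝕍^{(c)}` this is — `ω_{V^{(c)}}(ν, ε′, χ′)`, `ε = −ε′`, `χ = χ′⁻¹` — is the cited convention's sentence,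
   not a kernel statement); (ii) `D.epsOf e = U.epsOf (−e)` (Def. 4.12 last sentence; conjugate normaliser `δ̄′ = −δ′`, ✔ `AdapterRelabel.epsOf_neg_normaliser`);
   (iii) the tail AT `ν`: `D.Obj = PLift (Nonempty (Def45.CMDatum φ ι hν hw Car))` — CM data FOR `ν`, `D.HomK K D_ν = ℚ ⊗_ℤ Hom_E(Alb_{X_{levelOf K}}, A_ν)` at the
   CHOSEN `A_ν` (= ✔ `RestOne.homK_toThm418Data_restOne`), `D.Ω = ΩOne …` (`Hom_E(A_∞, A_ν)_ℚ` over `M_ν`), `D.rhoΩ = rhoΩ`, `D.res K D_ν = resOne … (levelOf K) D_ν`;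
   (iv) Def. 4.12 AT `ν`: `D.IsAdmissible ε ↔ ∃ e Φ_ν-adm., U.epsOf (−e) = ε ↔ ∃ e Φ_{νᶜ}-adm., U.epsOf e = ε`, `D.AdmIndex` spelled out; BUNDLED:
   `muConj_rest_restTailOne_eq_restOne`, `toThm418Data_muConj_rest_eq_printed`, `thm418AsPrinted_muConj_rest_iff_printed` (the ROW, `Iff.rfl`), `…_hecke` — right-hand
   sides = the tree's ONE-OBJECT REST of [Thm. 4.18] AT `ν` (✔ `AppendixC/RestOne.lean`, `Obj ∕ A_ν ∕ Ω(ν) ∕ res` REAL) with the carriers DISPLAYED, no `muConj` on the right.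
§2 AT THE PIN PRESENTATION `(AlgHom.id ℚ E, ι₁, Carriers.ofPolDR ν (PolDR ι₁ hν (RMuForm ι₁ hν)))`, `rhoΩ := T.rhoΩOne …` — the END's tail shape.
§3 AT THE OBJECTS OF RECORD — the literal datum of `hLiuC` (`ℭ := sec42DataOf …`, `𝕌(a) := uniformOmegaRep …` of the line `⟨a⟩`, `𝕋 := heckeTranslatesFamilyOf …`):
   scalar-keyed (`a : RealScalar F`, the `ClosedPrintedMuKey` edition) and line-keyed (`a := repAt a₀ i.fst`, ✔ p374084 :273–:277), so each END's specialisation is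
   a term of this file, not a stand-in (d2bridge-ref G45 §1 R1, cite-1 DELTA 108 C1).
§4 SPACE, kernel half of (e): `ℭ.X_K = M_K ⊗_{F,c} F` — the §4.2 datum's variety IS the `c`-twist of the chosen canonical-model record (✔ `recordFunctorOf_eq`,
   ✔ `conjSystem_obj`), at `sec42DataOfFourLe` and at the literal `sec42DataOf …` ∕ `levelOf K`.  RIDER (desk ∕ print, d2bridge-ref G45 §0): «`M^{(c)} ≅ X(𝕍^{(c)})`»
   is transport of structure of the CONSTRUCTION along `c` — no construction `X(·)` of Liu's `Sh(𝕍)` in the tree, no canonical-model uniqueness asserted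
   ([Milne2005] Thm. 13.7 (a)); the CM-side re-keying is ✔ `AdapterRelabel.isReflexOfTypeG_cmType_iff_starRingEnd_comp_galConj` (K1).
NOT HERE: `D_BMM` (Literature, bmmdef-1); any END; any claim that a displayed citation is inhabited.  HC_CM is NOT proved by this file.
References: [Liu2021] Thm. 4.18 (FJcycle.tex ll. 2232–2245), Rem. 4.4 (ll. 1912–1933), Def. 4.5 (2) (ll. 1944–1958), Def. 4.11 (ll. 2083–2097), Def. 4.12
(ll. 2102–2111), Def. 4.16 ∕ Rem. 4.17 (ll. 2215–2230), §4.2 (ll. 2053–2074), App. C Prop. C.5 (ll. 4627–4633); [BMM16] Bergeron–Millson–Moeglin, Acta Math. 216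
(2016), §5; [Deligne1979] *Variétés de Shimura*, 2.2.5; [Milne2005] *Introduction to Shimura varieties*, Thm. 13.7.
-/

noncomputable section

namespace Summit.HodgeConjecture.CorCM.D2Bridge.MuConjIdent

open NumberField
open Literature.AlgebraicGeometry.Motives (CMType)
open Literature.NumberTheory.Automorphic Literature.NumberTheory.Automorphic.IdeleClassGroup
open Literature.NumberTheory.Automorphic.Liu2021 Literature.NumberTheory.Automorphic.Liu2021.AppendixC
open Literature.NumberTheory.Automorphic.Liu2021.AppendixC.RestOne (ObjOne datum ΩOne resOne)
open Literature.NumberTheory.ComplexMultiplication.CMTypeOps (bar bar_bar coe_bar_eq_setOf_conjugate_mem)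
open Literature.AlgebraicGeometry.Liu2021 (IsAdmissibleElement isAdmissibleElement_conj_neg_iff)
open Summit.HodgeConjecture.CorCM.D2Bridge.AdapterMuConj (muConj)

/-! ## §1 GENERIC: the components of `toThm418Data C ((muConj U).rest (restTailOne φ ι hν hw Car rhoΩ))` -/

section Generic
-- As in `AdapterMuConj.lean` §1: the class parameters of the App-C context are IMPLICIT binders; these `variable`s are types ∕ instances only.
variable {F E : Type} {iF₁ : Field F} {iF₂ : NumberField F} {iF₃ : IsTotallyReal F} {iE₁ : Field E} {iE₂ : NumberField E}
  {iA : Algebra F E} {iE₃ : IsTotallyComplex E} {iQ : Algebra.IsQuadraticExtension F E} {iCM : IsCMField E}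
  {P5 : PropC5Data F E} {isotropicAt : ℕ → Prop} {C : Sec42Data P5 isotropicAt}
  {L : Type} {iL₁ : Field L} {iL₂ : NumberField L} {iL₃ : IsGalois ℚ L}

/-- **The group is `𝔾(𝔸_F^∞)` of the App-C datum** (`rfl`; likewise `n = P5.n`, `𝕍 = P5.𝕍`, Glue :531–:551). [cite: Liu2021, §4.2 (FJcycle.tex ll. 2053–2060)] -/
theorem G_eq (U : UniformOmega C) (ν : Literature.NumberTheory.Automorphic.IdeleClassGroup E →ₜ* Circle)
    (hν : IdeleClassGroup.IsConjugateSymplectic E ν) (hw : IdeleClassGroup.HasWeight E ν 1)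
    (φ : E →ₐ[ℚ] L) (ι : L →+* ℂ) (Car : Def45.Carriers E ν) (rhoΩ : Representation (fieldOfValues E ν) C.G (ΩOne C φ ι hν hw Car)) :
    (toThm418Data C ((muConj U).rest (restTailOne φ ι hν hw Car rhoΩ))).G = C.G := rfl

/-- **THE CHARACTER OF THE DATUM IS `ν`** (REAL; not `νᶜ`): «Let `μ` be a conjugate symplectic character of weight one» of Def. 4.16 ∕ Thm. 4.18 is
read at `μ := ν` (`rfl`). [cite: Liu2021, Def. 4.16 (FJcycle.tex l. 2219), Thm. 4.18 (ll. 2232–2237)] -/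
theorem mu_eq (U : UniformOmega C) (ν : Literature.NumberTheory.Automorphic.IdeleClassGroup E →ₜ* Circle)
    (hν : IdeleClassGroup.IsConjugateSymplectic E ν) (hw : IdeleClassGroup.HasWeight E ν 1)
    (φ : E →ₐ[ℚ] L) (ι : L →+* ℂ) (Car : Def45.Carriers E ν) (rhoΩ : Representation (fieldOfValues E ν) C.G (ΩOne C φ ι hν hw Car)) :
    (toThm418Data C ((muConj U).rest (restTailOne φ ι hν hw Car rhoΩ))).μ = ν := rfl

/-- **`Φ_μ` of the datum is `Φ_ν`**, the CM type of `ν` (Def. 4.3 (2)) (`rfl`). [cite: Liu2021, Def. 4.3 (2) (FJcycle.tex l. 1919)] -/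
theorem cmType_eq (U : UniformOmega C) (ν : Literature.NumberTheory.Automorphic.IdeleClassGroup E →ₜ* Circle)
    (hν : IdeleClassGroup.IsConjugateSymplectic E ν) (hw : IdeleClassGroup.HasWeight E ν 1)
    (φ : E →ₐ[ℚ] L) (ι : L →+* ℂ) (Car : Def45.Carriers E ν) (rhoΩ : Representation (fieldOfValues E ν) C.G (ΩOne C φ ι hν hw Car)) :
    (toThm418Data C ((muConj U).rest (restTailOne φ ι hν hw Car rhoΩ))).cmType = hν.cmType := rfl

/-- … **and `Φ_ν = Φ̄_{νᶜ}`** ([Liu2021] Rem. 4.4 at `μ := νᶜ`; ✔ `IsConjugateSymplectic.cmType_galConj`, ✔ `bar_bar`): the CM type at which the datum's Def. 4.5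
objects and Def. 4.12 admissibility live is the CONJUGATE of the line's `Φ_{νᶜ}`. [cite: Liu2021, Rem. 4.4 (FJcycle.tex ll. 1930–1933)] -/
theorem cmType_eq_bar_cmType_galConj (U : UniformOmega C) (ν : Literature.NumberTheory.Automorphic.IdeleClassGroup E →ₜ* Circle)
    (hν : IdeleClassGroup.IsConjugateSymplectic E ν) (hw : IdeleClassGroup.HasWeight E ν 1)
    (φ : E →ₐ[ℚ] L) (ι : L →+* ℂ) (Car : Def45.Carriers E ν) (rhoΩ : Representation (fieldOfValues E ν) C.G (ΩOne C φ ι hν hw Car)) :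
    (toThm418Data C ((muConj U).rest (restTailOne φ ι hν hw Car rhoΩ))).cmType = bar hν.galConj.cmType := by
  rw [cmType_eq, hν.cmType_galConj, bar_bar]

/-- **The collections `ε` are the line's** (`rfl`). [cite: Liu2021, Def. 4.11 (FJcycle.tex l. 2088)] -/
theorem Eps_eq (U : UniformOmega C) (ν : Literature.NumberTheory.Automorphic.IdeleClassGroup E →ₜ* Circle)
    (hν : IdeleClassGroup.IsConjugateSymplectic E ν) (hw : IdeleClassGroup.HasWeight E ν 1)
    (φ : E →ₐ[ℚ] L) (ι : L →+* ℂ) (Car : Def45.Carriers E ν) (rhoΩ : Representation (fieldOfValues E ν) C.G (ΩOne C φ ι hν hw Car)) :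
    (toThm418Data C ((muConj U).rest (restTailOne φ ι hν hw Car rhoΩ))).Eps = U.Eps := rfl

/-- **The characters `χ` are the line's** (`rfl`). [cite: Liu2021, Def. 4.11 (FJcycle.tex l. 2090)] -/
theorem Chi_eq (U : UniformOmega C) (ν : Literature.NumberTheory.Automorphic.IdeleClassGroup E →ₜ* Circle)
    (hν : IdeleClassGroup.IsConjugateSymplectic E ν) (hw : IdeleClassGroup.HasWeight E ν 1)
    (φ : E →ₐ[ℚ] L) (ι : L →+* ℂ) (Car : Def45.Carriers E ν) (rhoΩ : Representation (fieldOfValues E ν) C.G (ΩOne C φ ι hν hw Car)) :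
    (toThm418Data C ((muConj U).rest (restTailOne φ ι hν hw Car rhoΩ))).Chi = U.Chi := rfl

/-- **(ii) Def. 4.12's collection map is read at `−e`**: `epsOf e = U.epsOf (−e)` — the classes of `e ∕ δ̄′` at the conjugate normaliser `δ̄′ = −δ′`
(✔ `AdapterRelabel.epsOf_neg_normaliser`); Def. 4.12, last sentence «`ε` is `μ`-admissible iff `−ε` is `μᶜ`-admissible» (`rfl`). [cite: Liu2021, Def. 4.12 (FJcycle.tex ll. 2102–2111)] -/
theorem epsOf_eq (U : UniformOmega C) (ν : Literature.NumberTheory.Automorphic.IdeleClassGroup E →ₜ* Circle)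
    (hν : IdeleClassGroup.IsConjugateSymplectic E ν) (hw : IdeleClassGroup.HasWeight E ν 1)
    (φ : E →ₐ[ℚ] L) (ι : L →+* ℂ) (Car : Def45.Carriers E ν) (rhoΩ : Representation (fieldOfValues E ν) C.G (ΩOne C φ ι hν hw Car)) (e : E) :
    (toThm418Data C ((muConj U).rest (restTailOne φ ι hν hw Car rhoΩ))).epsOf e = U.epsOf (-e) := rfl

/-- **(i) The oscillator blocks of the datum are the line's blocks at the label `νᶜ`**: `ω(·)(ε, χ) = U.omega νᶜ hν.galConj ε χ` as a family of
`ℂ`-spaces (✔ `AdapterMuConj.muConj_omega`; `rfl`).  Which PRINTED block of `𝕍^{(c)}` this is — `ω_{V^{(c)}}(ν, ε′, χ′) = ω_V(νᶜ, −ε′, χ′⁻¹)` — is the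
sentence of the cited convention `D_BMM` ∕ the transport dictionary, not asserted here. [cite: Liu2021, Def. 4.11 (FJcycle.tex ll. 2092–2096), Rem. 4.4] -/
theorem omega_eq (U : UniformOmega C) (ν : Literature.NumberTheory.Automorphic.IdeleClassGroup E →ₜ* Circle)
    (hν : IdeleClassGroup.IsConjugateSymplectic E ν) (hw : IdeleClassGroup.HasWeight E ν 1)
    (φ : E →ₐ[ℚ] L) (ι : L →+* ℂ) (Car : Def45.Carriers E ν) (rhoΩ : Representation (fieldOfValues E ν) C.G (ΩOne C φ ι hν hw Car)) :
    (toThm418Data C ((muConj U).rest (restTailOne φ ι hν hw Car rhoΩ))).omega =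
      U.omega (galConj (IsCMField.complexConj E) ν) hν.galConj := rfl

/-- (i) at an admissible index `i = (ε, χ)`: the summand `ω_i` IS `U.omega νᶜ hν.galConj ε χ` (`rfl`). [cite: Liu2021, Thm. 4.18 (FJcycle.tex ll. 2232–2237), Def. 4.11] -/
theorem omegaAt_eq (U : UniformOmega C) (ν : Literature.NumberTheory.Automorphic.IdeleClassGroup E →ₜ* Circle)
    (hν : IdeleClassGroup.IsConjugateSymplectic E ν) (hw : IdeleClassGroup.HasWeight E ν 1)
    (φ : E →ₐ[ℚ] L) (ι : L →+* ℂ) (Car : Def45.Carriers E ν) (rhoΩ : Representation (fieldOfValues E ν) C.G (ΩOne C φ ι hν hw Car))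
    (i : (toThm418Data C ((muConj U).rest (restTailOne φ ι hν hw Car rhoΩ))).AdmIndex) :
    (toThm418Data C ((muConj U).rest (restTailOne φ ι hν hw Car rhoΩ))).omegaAt i =
      U.omega (galConj (IsCMField.complexConj E) ν) hν.galConj i.1.1 i.1.2 := rfl

/-- (i) … with the line's `𝔾(𝔸_F^∞)`-action at the label `νᶜ`: `rhoAt i = U.rho νᶜ hν.galConj ε χ` (`rfl`). [cite: Liu2021, Def. 4.11 (FJcycle.tex ll. 2092–2096)] -/
theorem rhoAt_eq (U : UniformOmega C) (ν : Literature.NumberTheory.Automorphic.IdeleClassGroup E →ₜ* Circle)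
    (hν : IdeleClassGroup.IsConjugateSymplectic E ν) (hw : IdeleClassGroup.HasWeight E ν 1)
    (φ : E →ₐ[ℚ] L) (ι : L →+* ℂ) (Car : Def45.Carriers E ν) (rhoΩ : Representation (fieldOfValues E ν) C.G (ΩOne C φ ι hν hw Car))
    (i : (toThm418Data C ((muConj U).rest (restTailOne φ ι hν hw Car rhoΩ))).AdmIndex) :
    (toThm418Data C ((muConj U).rest (restTailOne φ ι hν hw Car rhoΩ))).rhoAt i =
      U.rho (galConj (IsCMField.complexConj E) ν) hν.galConj i.1.1 i.1.2 := rfl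

/-- **(iii) The objects `D_μ ∈ 𝒜(μ)` of the datum are Def. 4.5 (2) CM DATA FOR `ν`** (not for `νᶜ`): `Obj = ObjOne φ ι hν hw Car =
PLift (Nonempty (Def45.CMDatum φ ι hν hw Car))` — quadruples `(A, i : M_ν → End⁰ A, λ, r)` with `[M_ν:ℚ] = 2 dim A`, Def. 4.5 (2)'s first bullet against
`η_ν`, the CM-character bullet for `ν` and `(λ_ν, r_ν)` (`rfl`). [cite: Liu2021, Def. 4.5 (2) (FJcycle.tex ll. 1944–1958), Thm. 4.18 proof l. 2232] -/
theorem Obj_eq (U : UniformOmega C) (ν : Literature.NumberTheory.Automorphic.IdeleClassGroup E →ₜ* Circle)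
    (hν : IdeleClassGroup.IsConjugateSymplectic E ν) (hw : IdeleClassGroup.HasWeight E ν 1)
    (φ : E →ₐ[ℚ] L) (ι : L →+* ℂ) (Car : Def45.Carriers E ν) (rhoΩ : Representation (fieldOfValues E ν) C.G (ΩOne C φ ι hν hw Car)) :
    (toThm418Data C ((muConj U).rest (restTailOne φ ι hν hw Car rhoΩ))).Obj = PLift (Nonempty (Def45.CMDatum φ ι hν hw Car)) := rfl

/-- (iii) hence a consumer's `hObj : Nonempty D.Obj` IS Prop. 4.6 (1) «`𝒜(ν)` is nonempty» over CM data FOR `ν`. [cite: Liu2021, Prop. 4.6 (1) (FJcycle.tex ll. 1966–1969)] -/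
theorem nonempty_obj_iff (U : UniformOmega C) (ν : Literature.NumberTheory.Automorphic.IdeleClassGroup E →ₜ* Circle)
    (hν : IdeleClassGroup.IsConjugateSymplectic E ν) (hw : IdeleClassGroup.HasWeight E ν 1)
    (φ : E →ₐ[ℚ] L) (ι : L →+* ℂ) (Car : Def45.Carriers E ν) (rhoΩ : Representation (fieldOfValues E ν) C.G (ΩOne C φ ι hν hw Car)) :
    Nonempty (toThm418Data C ((muConj U).rest (restTailOne φ ι hν hw Car rhoΩ))).Obj ↔ Nonempty (Def45.CMDatum φ ι hν hw Car) :=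
  RestOne.nonempty_objOne_iff φ ι hν hw Car

/-- **(iii) `Hom_E(A_K, A_μ)_ℚ` of the datum is the REAL group `ℚ ⊗_ℤ Hom_E(Alb_{X_{levelOf K}}, A_ν)` at the CHOSEN `A_ν = (datum D_ν).A`** — the
Albanese `A_K` of the Appendix-C datum's `X_K` against the abelian variety of a CM datum FOR `ν` (= ✔ `RestOne.homK_toThm418Data_restOne` at the
relabelled rest; `rfl`). [cite: Liu2021, Thm. 4.18 (1) (FJcycle.tex ll. 2235–2239), §4.2 l. 2066–2072] -/
theorem HomK_eq (U : UniformOmega C) (ν : Literature.NumberTheory.Automorphic.IdeleClassGroup E →ₜ* Circle)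
    (hν : IdeleClassGroup.IsConjugateSymplectic E ν) (hw : IdeleClassGroup.HasWeight E ν 1)
    (φ : E →ₐ[ℚ] L) (ι : L →+* ℂ) (Car : Def45.Carriers E ν) (rhoΩ : Representation (fieldOfValues E ν) C.G (ΩOne C φ ι hν hw Car))
    (K : Subgroup C.G) (Dν : ObjOne φ ι hν hw Car) :
    (toThm418Data C ((muConj U).rest (restTailOne φ ι hν hw Car rhoΩ))).HomK K Dν = C.HomQ (C.levelOf K) (datum φ ι hν hw Car Dν).A := rfl

/-- **(iii) `Ω(μ)` of the datum is `Ω(ν) = Hom_E(A_∞, A_ν)_ℚ` over `M_ν`** (`ΩOne`, Def. 4.16 ∕ Rem. 4.17; `rfl`). [cite: Liu2021, Def. 4.16 and Rem. 4.17 (FJcycle.tex ll. 2215–2230)] -/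
theorem Ω_eq (U : UniformOmega C) (ν : Literature.NumberTheory.Automorphic.IdeleClassGroup E →ₜ* Circle)
    (hν : IdeleClassGroup.IsConjugateSymplectic E ν) (hw : IdeleClassGroup.HasWeight E ν 1)
    (φ : E →ₐ[ℚ] L) (ι : L →+* ℂ) (Car : Def45.Carriers E ν) (rhoΩ : Representation (fieldOfValues E ν) C.G (ΩOne C φ ι hν hw Car)) :
    (toThm418Data C ((muConj U).rest (restTailOne φ ι hν hw Car rhoΩ))).Ω = ΩOne C φ ι hν hw Car := rfl

/-- (iii) the `𝔾(𝔸_F^∞)`-action on `Ω(ν)` is the given Hecke action `rhoΩ` (`rfl`). [cite: Liu2021, Def. 4.16 (FJcycle.tex l. 2219), §4.2 l. 2074] -/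
theorem rhoΩ_eq (U : UniformOmega C) (ν : Literature.NumberTheory.Automorphic.IdeleClassGroup E →ₜ* Circle)
    (hν : IdeleClassGroup.IsConjugateSymplectic E ν) (hw : IdeleClassGroup.HasWeight E ν 1)
    (φ : E →ₐ[ℚ] L) (ι : L →+* ℂ) (Car : Def45.Carriers E ν) (rhoΩ : Representation (fieldOfValues E ν) C.G (ΩOne C φ ι hν hw Car)) :
    (toThm418Data C ((muConj U).rest (restTailOne φ ι hν hw Car rhoΩ))).rhoΩ = rhoΩ := rfl

/-- **(iii) the canonical map of item (1) is `res_{levelOf K}` into `Hom_E(A_∞, A_ν)_ℚ`** (`resOne`; `rfl`). [cite: Liu2021, §4.2 (FJcycle.tex ll. 2070–2072), Thm. 4.18 (1)] -/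
theorem res_eq (U : UniformOmega C) (ν : Literature.NumberTheory.Automorphic.IdeleClassGroup E →ₜ* Circle)
    (hν : IdeleClassGroup.IsConjugateSymplectic E ν) (hw : IdeleClassGroup.HasWeight E ν 1)
    (φ : E →ₐ[ℚ] L) (ι : L →+* ℂ) (Car : Def45.Carriers E ν) (rhoΩ : Representation (fieldOfValues E ν) C.G (ΩOne C φ ι hν hw Car))
    (K : Subgroup C.G) (Dν : ObjOne φ ι hν hw Car) :
    (toThm418Data C ((muConj U).rest (restTailOne φ ι hν hw Car rhoΩ))).res K Dν = resOne C φ ι hν hw Car (C.levelOf K) Dν := rfl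

/-- **(iv) Def. 4.12 AT `ν`**: `ε` is admissible for the datum iff some `e ∈ E^{×−}` with `Im τ′(e) < 0` for all `τ′ ∈ Φ_ν` generates it through the
datum's collection map `e ↦ U.epsOf (−e)` (`Iff.rfl`). [cite: Liu2021, Def. 4.12 (FJcycle.tex ll. 2102–2108)] -/
theorem isAdmissible_iff (U : UniformOmega C) (ν : Literature.NumberTheory.Automorphic.IdeleClassGroup E →ₜ* Circle)
    (hν : IdeleClassGroup.IsConjugateSymplectic E ν) (hw : IdeleClassGroup.HasWeight E ν 1)
    (φ : E →ₐ[ℚ] L) (ι : L →+* ℂ) (Car : Def45.Carriers E ν) (rhoΩ : Representation (fieldOfValues E ν) C.G (ΩOne C φ ι hν hw Car)) (ε : U.Eps) :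
    (toThm418Data C ((muConj U).rest (restTailOne φ ι hν hw Car rhoΩ))).IsAdmissible ε ↔
      ∃ e : E, IsAdmissibleElement E hν.cmType.1 e ∧ U.epsOf (-e) = ε := Iff.rfl

/-- **(iv) … equivalently, through `e ↦ −e` (Def. 4.12, last sentence), `ε` is admissible for the datum iff it is the line's collection `U.epsOf e` of a
`Φ_{νᶜ}`-admissible `e`** — the line's `νᶜ`-admissible index, UNCHANGED (✔ `isAdmissibleElement_conj_neg_iff`; cf. ✔ `AdapterMuConj.isAdmissible_muConj_iff`).
[cite: Liu2021, Def. 4.12 (FJcycle.tex ll. 2102–2111), Rem. 4.4 (ll. 1930–1933)] -/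
theorem isAdmissible_iff_galConj (U : UniformOmega C) (ν : Literature.NumberTheory.Automorphic.IdeleClassGroup E →ₜ* Circle)
    (hν : IdeleClassGroup.IsConjugateSymplectic E ν) (hw : IdeleClassGroup.HasWeight E ν 1)
    (φ : E →ₐ[ℚ] L) (ι : L →+* ℂ) (Car : Def45.Carriers E ν) (rhoΩ : Representation (fieldOfValues E ν) C.G (ΩOne C φ ι hν hw Car)) (ε : U.Eps) :
    (toThm418Data C ((muConj U).rest (restTailOne φ ι hν hw Car rhoΩ))).IsAdmissible ε ↔
      ∃ e : E, IsAdmissibleElement E hν.galConj.cmType.1 e ∧ U.epsOf e = ε := by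
  rw [isAdmissible_iff, hν.cmType_galConj, coe_bar_eq_setOf_conjugate_mem]
  constructor
  · rintro ⟨e, he, hε⟩
    exact ⟨-e, (isAdmissibleElement_conj_neg_iff hν.cmType.1 e).2 he, hε⟩
  · rintro ⟨e, he, hε⟩
    exact ⟨-e, (isAdmissibleElement_conj_neg_iff hν.cmType.1 (-e)).1 (by rwa [neg_neg]), by rwa [neg_neg]⟩

/-- **(iv) the index set of the direct sum**: pairs `(ε, χ)` with `ε` admissible AT `ν` through `e ↦ U.epsOf (−e)` (`rfl`). [cite: Liu2021, Thm. 4.18 (FJcycle.tex l. 2237), Def. 4.12] -/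
theorem AdmIndex_eq (U : UniformOmega C) (ν : Literature.NumberTheory.Automorphic.IdeleClassGroup E →ₜ* Circle)
    (hν : IdeleClassGroup.IsConjugateSymplectic E ν) (hw : IdeleClassGroup.HasWeight E ν 1)
    (φ : E →ₐ[ℚ] L) (ι : L →+* ℂ) (Car : Def45.Carriers E ν) (rhoΩ : Representation (fieldOfValues E ν) C.G (ΩOne C φ ι hν hw Car)) :
    (toThm418Data C ((muConj U).rest (restTailOne φ ι hν hw Car rhoΩ))).AdmIndex =
      {p : U.Eps × U.Chi // ∃ e : E, IsAdmissibleElement E hν.cmType.1 e ∧ U.epsOf (-e) = p.1} := rfl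

/-- **BUNDLED, at the level of the rest**: the relabelled rest IS the tree's ONE-OBJECT REST of [Thm. 4.18] AT `ν` (✔ `RestOne.restOne`: `Obj ∕ A_ν ∕ Ω(ν) ∕ res`
REAL) with DISPLAYED carriers `U.Eps` via `e ↦ U.epsOf (−e)`, `U.Chi`, blocks `U.omega νᶜ _` ∕ `U.rho νᶜ _`, `rhoΩ` — FIELDS MATCH (`rfl`); no `muConj` on the right.
[cite: Liu2021, Thm. 4.18 (FJcycle.tex ll. 2232–2245), Def. 4.5 (2), Def. 4.11, Def. 4.12, Def. 4.16, Rem. 4.17] -/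
theorem muConj_rest_restTailOne_eq_restOne (U : UniformOmega C) (ν : Literature.NumberTheory.Automorphic.IdeleClassGroup E →ₜ* Circle)
    (hν : IdeleClassGroup.IsConjugateSymplectic E ν) (hw : IdeleClassGroup.HasWeight E ν 1)
    (φ : E →ₐ[ℚ] L) (ι : L →+* ℂ) (Car : Def45.Carriers E ν) (rhoΩ : Representation (fieldOfValues E ν) C.G (ΩOne C φ ι hν hw Car)) :
    (muConj U).rest (restTailOne φ ι hν hw Car rhoΩ) =
      RestOne.restOne C φ ι hν hw Car U.Eps (fun e => U.epsOf (-e)) U.Chi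
        (U.omega (galConj (IsCMField.complexConj E) ν) hν.galConj) (U.rho (galConj (IsCMField.complexConj E) ν) hν.galConj) rhoΩ := rfl

/-- **THE IDENTIFICATION LEMMA** (`toThm418Data_muConj_rest_eq_printed`): the [Liu2021, Thm. 4.18] datum the END's row `hLiuC` consumes,
`toThm418Data C ((muConj U).rest (restTailOne φ ι hν hw Car rhoΩ))`, IS the Thm. 4.18 datum presented through Appendix C at the one-object rest AT `ν`
with displayed Weil-side carriers: group `𝔾(𝔸_F^∞) = C.G`, space token `𝕍`, `X_K ∕ A_K = Alb_{X_K}` of `C`, character `ν` (conjugate symplectic,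
weight one), objects = Def. 4.5 (2) CM data FOR `ν`, `Hom_E(A_K, A_ν)_ℚ`, `Ω(ν) = Hom_E(A_∞, A_ν)_ℚ` with `rhoΩ`, index set = Def. 4.12 AT `ν` through
`e ↦ U.epsOf (−e)`, summands `U.omega νᶜ hν.galConj ε χ` (`rfl`).  Under the cited convention `D_BMM` (displayed by the END, consumed nowhere) this is
the printed datum of Thm. 4.18 for `(X(𝕍^{(c)}), ν)`; HC_CM is NOT proved here. [cite: Liu2021, Thm. 4.18 (FJcycle.tex ll. 2232–2245), Rem. 4.4, Def. 4.12] -/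
theorem toThm418Data_muConj_rest_eq_printed (U : UniformOmega C) (ν : Literature.NumberTheory.Automorphic.IdeleClassGroup E →ₜ* Circle)
    (hν : IdeleClassGroup.IsConjugateSymplectic E ν) (hw : IdeleClassGroup.HasWeight E ν 1)
    (φ : E →ₐ[ℚ] L) (ι : L →+* ℂ) (Car : Def45.Carriers E ν) (rhoΩ : Representation (fieldOfValues E ν) C.G (ΩOne C φ ι hν hw Car)) :
    toThm418Data C ((muConj U).rest (restTailOne φ ι hν hw Car rhoΩ)) =
      toThm418Data C (RestOne.restOne C φ ι hν hw Car U.Eps (fun e => U.epsOf (-e)) U.Chi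
        (U.omega (galConj (IsCMField.complexConj E) ν) hν.galConj) (U.rho (galConj (IsCMField.complexConj E) ν) hν.galConj) rhoΩ) := rfl

/-- **THE ROW, re-presented**: [Liu2021, Thm. 4.18] AS PRINTED at the datum of `hLiuC` ↔ AS PRINTED at the one-object rest AT `ν` with the displayed
carriers (`Iff.rfl`; no instance of Thm. 4.18 is consumed or produced). [cite: Liu2021, Thm. 4.18 (FJcycle.tex ll. 2232–2245)] -/
theorem thm418AsPrinted_muConj_rest_iff_printed (U : UniformOmega C) (ν : Literature.NumberTheory.Automorphic.IdeleClassGroup E →ₜ* Circle)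
    (hν : IdeleClassGroup.IsConjugateSymplectic E ν) (hw : IdeleClassGroup.HasWeight E ν 1)
    (φ : E →ₐ[ℚ] L) (ι : L →+* ℂ) (Car : Def45.Carriers E ν) (rhoΩ : Representation (fieldOfValues E ν) C.G (ΩOne C φ ι hν hw Car)) :
    Thm418AsPrinted (toThm418Data C ((muConj U).rest (restTailOne φ ι hν hw Car rhoΩ))) ↔
      Thm418AsPrinted (toThm418Data C (RestOne.restOne C φ ι hν hw Car U.Eps (fun e => U.epsOf (-e)) U.Chi
        (U.omega (galConj (IsCMField.complexConj E) ν) hν.galConj) (U.rho (galConj (IsCMField.complexConj E) ν) hν.galConj) rhoΩ)) :=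
  Iff.rfl

/-- **The identification with the Hecke action CONSTRUCTED** (`rhoΩ := T.rhoΩOne …`, ✔ `AppendixC/RestOneHecke.lean` — the END's shape): the datum IS
`toThm418Data C (T.restOne φ ι hν hw Car …)`, `Obj ∕ A_ν ∕ Ω(ν) ∕ rhoΩ ∕ res` ALL constructed (`rfl`). [cite: Liu2021, Thm. 4.18 (FJcycle.tex ll. 2232–2245), Def. 4.16 (l. 2219)] -/
theorem toThm418Data_muConj_rest_eq_printed_hecke (U : UniformOmega C) (T : C.HeckeTranslates)
    (ν : Literature.NumberTheory.Automorphic.IdeleClassGroup E →ₜ* Circle)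
    (hν : IdeleClassGroup.IsConjugateSymplectic E ν) (hw : IdeleClassGroup.HasWeight E ν 1)
    (φ : E →ₐ[ℚ] L) (ι : L →+* ℂ) (Car : Def45.Carriers E ν) :
    toThm418Data C ((muConj U).rest (restTailOne φ ι hν hw Car (T.rhoΩOne φ ι hν hw Car))) =
      toThm418Data C (T.restOne φ ι hν hw Car U.Eps (fun e => U.epsOf (-e)) U.Chi
        (U.omega (galConj (IsCMField.complexConj E) ν) hν.galConj) (U.rho (galConj (IsCMField.complexConj E) ν) hν.galConj)) := rfl

end Generic

/-! ## §2 AT THE PIN PRESENTATION `(φ, ι, Car) = (AlgHom.id ℚ E, ι₁, Carriers.ofPolDR ν (PolDR ι₁ hν (RMuForm ι₁ hν)))` — the literal tail of the END -/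

section AtPin

variable {F E : Type} {iF₁ : Field F} {iF₂ : NumberField F} {iF₃ : IsTotallyReal F} {iE₁ : Field E} {iE₂ : NumberField E}
  {iA : Algebra F E} {iE₃ : IsTotallyComplex E} {iQ : Algebra.IsQuadraticExtension F E} {iCM : IsCMField E} {iG : IsGalois ℚ E}
  {P5 : PropC5Data F E} {isotropicAt : ℕ → Prop} {C : Sec42Data P5 isotropicAt}

/-- **THE IDENTIFICATION LEMMA at the pin presentation, Hecke action CONSTRUCTED** — the END's literal tail `restTailOne (AlgHom.id ℚ _) ι₁ hν hw
(Carriers.ofPolDR ν (PolDR ι₁ hν (RMuForm ι₁ hν))) (T.rhoΩOne …)` over ANY `C`, `U`, `T`: the datum IS `toThm418Data C (T.restOne (AlgHom.id ℚ E) ι₁ hν hw …)`, the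
one-object rest AT `ν` at `(id, ι₁)` with the line's displayed carriers; its objects are `PLift (Nonempty (Def45.CMDatum (AlgHom.id ℚ E) ι₁ hν hw (Carriers.ofPolDR ν
(PolDR ι₁ hν (RMuForm ι₁ hν)))))` — CM data FOR `ν` (`Obj_eq`); for a general `rhoΩ` use `toThm418Data_muConj_rest_eq_printed` at `φ := AlgHom.id ℚ E`.
[cite: Liu2021, Thm. 4.18 (FJcycle.tex ll. 2232–2245), Def. 4.5 (2), Def. 4.16 (l. 2219), §4.2 l. 2074] -/
theorem toThm418Data_muConj_rest_eq_printed_hecke_atPin (U : UniformOmega C) (T : C.HeckeTranslates) (ι₁ : E →+* ℂ)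
    (ν : Literature.NumberTheory.Automorphic.IdeleClassGroup E →ₜ* Circle)
    (hν : IdeleClassGroup.IsConjugateSymplectic E ν) (hw : IdeleClassGroup.HasWeight E ν 1) :
    toThm418Data C ((muConj U).rest (restTailOne (AlgHom.id ℚ E) ι₁ hν hw
        (Def45.Carriers.ofPolDR ν (Def45.PolDR ι₁ hν (Def45.RMuForm ι₁ hν)))
        (T.rhoΩOne (AlgHom.id ℚ E) ι₁ hν hw (Def45.Carriers.ofPolDR ν (Def45.PolDR ι₁ hν (Def45.RMuForm ι₁ hν)))))) =
      toThm418Data C (T.restOne (AlgHom.id ℚ E) ι₁ hν hw (Def45.Carriers.ofPolDR ν (Def45.PolDR ι₁ hν (Def45.RMuForm ι₁ hν)))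
        U.Eps (fun e => U.epsOf (-e)) U.Chi (U.omega (galConj (IsCMField.complexConj E) ν) hν.galConj)
        (U.rho (galConj (IsCMField.complexConj E) ν) hν.galConj)) :=
  toThm418Data_muConj_rest_eq_printed_hecke U T ν hν hw (AlgHom.id ℚ E) ι₁ _

end AtPin

/-! ## §3 AT THE OBJECTS OF RECORD — the literal datum of the END's row `hLiuC` (✔ `ClosedPrintedMuConj.lean` = p374084, :273–:277) -/

section OfRecord

open HodgeCM.Model HodgeCM.Model.LiuIndex
open Summit.HodgeConjecture.CorCM.Model
open Literature.AlgebraicGeometry.ShimuraVarieties.UnitaryCanonicalModel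
open Literature.NumberTheory.Automorphic.Liu2021.Def411WeilCarriers (locF Rep)
open Summit.HodgeConjecture.CorCM.Transposition.OmegaTransport (realUnit)
open HodgeCM.Model.ArchSideTerm (e₁)
open Literature.NumberTheory.GelbartRogawski1991 Literature.NumberTheory.GelbartRogawski1991.UnitaryDualPair
open Summit.HodgeConjecture.CorCM.Transposition

set_option synthInstance.maxHeartbeats 400000 in
set_option maxHeartbeats 1600000 in
/-- **THE IDENTIFICATION LEMMA AT THE OBJECTS OF RECORD, scalar-keyed** (`F` Galois CM, `6 ≤ [F:ℚ]`, face `(ι₁, V)`, line `⟨a⟩` of a non-zero `c`-fixed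
Gram scalar `a`, record `h`, type token `Φ`, conjugate-symplectic weight-one `ν`): the datum of the END's Thm 4.18 row — VERBATIM the subterm of the scalar-keyed
edition (`ClosedPrintedMuKey`) and, at `a := repAt a₀ i.fst`, of ✔ `ClosedPrintedMuConj` p374084 :273–:277 (next theorem) — over `ℭ := sec42DataOf h isoOf F ι₁ V Φ`,
the RELABELLED carriers `muConj 𝕌(a)` (`𝕌(a) := uniformOmegaRep … (2δ_F)⁻¹ (Rep.update … ⟨a⟩ …)`) and the tail AT `ν` with the Hecke action of record `𝕋.rhoΩOne …`,
IS `toThm418Data ℭ (𝕋.restOne (AlgHom.id ℚ F) ι₁ hν hw (Carriers.ofPolDR ν (PolDR ι₁ hν (RMuForm ι₁ hν))) 𝕌(a).Eps (e ↦ 𝕌(a).epsOf (−e)) 𝕌(a).Chi (𝕌(a).omega νᶜ _) (𝕌(a).rho νᶜ _))`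
— the one-object rest AT `ν` OF RECORD (CM data FOR `ν`; `Hom_F(Alb(ℭ.X_K), A_ν)_ℚ` with `ℭ.X_K = M_K ⊗_{F,c} F`, §4; `Ω(ν) = Hom_F(A_∞, A_ν)_ℚ`, Hecke action
CONSTRUCTED) with the line's carriers (normaliser `−(2δ_F)⁻¹ = \overline{(2δ_F)⁻¹}`).  Under the cited convention `D_BMM` this is [Liu2021, Thm. 4.18]'s datum for
`(X(𝕍^{(c)}), ν)`; nothing displayed by an END is inhabited here; HC_CM is NOT proved.
[cite: Liu2021, Thm. 4.18 (FJcycle.tex ll. 2232–2245), Rem. 4.4 (ll. 1912–1933), Def. 4.5 (2), Def. 4.11, Def. 4.12 (ll. 2102–2111), Def. 4.16, §4.2 (ll. 2053–2074)]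
[cite: Deligne1979ShimuraVarieties, 2.2.5] [cite: GelbartRogawski1991, §3.1 Prop. 3.1.1 p. 455 L1–3] -/
theorem toThm418Data_muConj_rest_eq_printed_ofRecord (F : HodgeCM.CMField) [IsGalois ℚ (F : Type)] (h6 : 6 ≤ Module.finrank ℚ (F : Type))
    {ι₁ : (F : Type) →+* ℂ} (V : HodgeCM.HermSpace3 F ι₁) (a : RealScalar F) (h : exists_recordSystem) (Φ : CMType (F : Type))
    (ν : Literature.NumberTheory.Automorphic.IdeleClassGroup (F : Type) →ₜ* Circle)
    (hν : IdeleClassGroup.IsConjugateSymplectic (F : Type) ν) (hw : IdeleClassGroup.HasWeight (F : Type) ν 1) :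
    toThm418Data _ ((Summit.HodgeConjecture.CorCM.D2Bridge.AdapterMuConj.muConj (uniformOmegaRep h ⟨HodgeCM.CMField.K F⟩ ι₁ ⟨HodgeCM.HermSpace3.Hm V, HodgeCM.HermSpace3.isHermitian V, HodgeCM.HermSpace3.signature_ι₁ V, HodgeCM.HermSpace3.posDef_of_ne V⟩ Φ e₁ (frameD V) (frameD_real V) (frameD_ne V) (ιVE V) (2 * imagUnit (HodgeCM.CMField.K F))⁻¹ (fun _ _ => (Rep.update ↥(maximalRealSubfield (HodgeCM.CMField.K F)) (imagUnitSq (HodgeCM.CMField.K F)) (Rep.ofLineOf ↥(maximalRealSubfield (HodgeCM.CMField.K F)) (imagUnitSq (HodgeCM.CMField.K F))) (locF ↥(maximalRealSubfield (HodgeCM.CMField.K F)) (imagUnitSq (HodgeCM.CMField.K F)) (realUnit ⟨HodgeCM.CMField.K F⟩ a.1 a.2.1 a.2.2)) (realUnit ⟨HodgeCM.CMField.K F⟩ a.1 a.2.1 a.2.2) rfl)))).rest (restTailOne (AlgHom.id ℚ _) ι₁ hν hw (Def45.Carriers.ofPolDR ν (Def45.PolDR ι₁ hν (Def45.RMuForm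 ι₁ hν))) ((heckeTranslatesFamilyOf heckeTranslate_definedOver_holds h isoOf ⟨HodgeCM.CMField.K F⟩ ι₁ ⟨HodgeCM.HermSpace3.Hm V, HodgeCM.HermSpace3.isHermitian V, HodgeCM.HermSpace3.signature_ι₁ V, HodgeCM.HermSpace3.posDef_of_ne V⟩ Φ h6).rhoΩOne (AlgHom.id ℚ _) ι₁ hν hw (Def45.Carriers.ofPolDR ν (Def45.PolDR ι₁ hν (Def45.RMuForm ι₁ hν)))))) =
      toThm418Data (sec42DataOf h isoOf ⟨HodgeCM.CMField.K F⟩ ι₁ ⟨HodgeCM.HermSpace3.Hm V, HodgeCM.HermSpace3.isHermitian V, HodgeCM.HermSpace3.signature_ι₁ V, HodgeCM.HermSpace3.posDef_of_ne V⟩ Φ)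
        ((heckeTranslatesFamilyOf heckeTranslate_definedOver_holds h isoOf ⟨HodgeCM.CMField.K F⟩ ι₁ ⟨HodgeCM.HermSpace3.Hm V, HodgeCM.HermSpace3.isHermitian V, HodgeCM.HermSpace3.signature_ι₁ V, HodgeCM.HermSpace3.posDef_of_ne V⟩ Φ h6).restOne (AlgHom.id ℚ _) ι₁ hν hw (Def45.Carriers.ofPolDR ν (Def45.PolDR ι₁ hν (Def45.RMuForm ι₁ hν)))
          (uniformOmegaRep h ⟨HodgeCM.CMField.K F⟩ ι₁ ⟨HodgeCM.HermSpace3.Hm V, HodgeCM.HermSpace3.isHermitian V, HodgeCM.HermSpace3.signature_ι₁ V, HodgeCM.HermSpace3.posDef_of_ne V⟩ Φ e₁ (frameD V) (frameD_real V) (frameD_ne V) (ιVE V) (2 * imagUnit (HodgeCM.CMField.K F))⁻¹ (fun _ _ => (Rep.update ↥(maximalRealSubfield (HodgeCM.CMField.K F)) (imagUnitSq (HodgeCM.CMField.K F)) (Rep.ofLineOf ↥(maximalRealSubfield (HodgeCM.CMField.K F)) (imagUnitSq (HodgeCM.CMField.K F))) (locF ↥(maximalRealSubfield (HodgeCM.CMField.K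 F)) (imagUnitSq (HodgeCM.CMField.K F)) (realUnit ⟨HodgeCM.CMField.K F⟩ a.1 a.2.1 a.2.2)) (realUnit ⟨HodgeCM.CMField.K F⟩ a.1 a.2.1 a.2.2) rfl))).Eps
          (fun e => (uniformOmegaRep h ⟨HodgeCM.CMField.K F⟩ ι₁ ⟨HodgeCM.HermSpace3.Hm V, HodgeCM.HermSpace3.isHermitian V, HodgeCM.HermSpace3.signature_ι₁ V, HodgeCM.HermSpace3.posDef_of_ne V⟩ Φ e₁ (frameD V) (frameD_real V) (frameD_ne V) (ιVE V) (2 * imagUnit (HodgeCM.CMField.K F))⁻¹ (fun _ _ => (Rep.update ↥(maximalRealSubfield (HodgeCM.CMField.K F)) (imagUnitSq (HodgeCM.CMField.K F)) (Rep.ofLineOf ↥(maximalRealSubfield (HodgeCM.CMField.K F)) (imagUnitSq (HodgeCM.CMField.K F))) (locF ↥(maximalRealSubfield (HodgeCM.CMField.K F)) (imagUnitSq (HodgeCM.CMField.K F)) (realUnit ⟨HodgeCM.CMField.K F⟩ a.1 a.2.1 a.2.2)) (realUnit ⟨HodgeCM.CMField.K F⟩ a.1 a.2.1 a.2.2) rfl))).epsOf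 (-e))
          (uniformOmegaRep h ⟨HodgeCM.CMField.K F⟩ ι₁ ⟨HodgeCM.HermSpace3.Hm V, HodgeCM.HermSpace3.isHermitian V, HodgeCM.HermSpace3.signature_ι₁ V, HodgeCM.HermSpace3.posDef_of_ne V⟩ Φ e₁ (frameD V) (frameD_real V) (frameD_ne V) (ιVE V) (2 * imagUnit (HodgeCM.CMField.K F))⁻¹ (fun _ _ => (Rep.update ↥(maximalRealSubfield (HodgeCM.CMField.K F)) (imagUnitSq (HodgeCM.CMField.K F)) (Rep.ofLineOf ↥(maximalRealSubfield (HodgeCM.CMField.K F)) (imagUnitSq (HodgeCM.CMField.K F))) (locF ↥(maximalRealSubfield (HodgeCM.CMField.K F)) (imagUnitSq (HodgeCM.CMField.K F)) (realUnit ⟨HodgeCM.CMField.K F⟩ a.1 a.2.1 a.2.2)) (realUnit ⟨HodgeCM.CMField.K F⟩ a.1 a.2.1 a.2.2) rfl))).Chi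
          ((uniformOmegaRep h ⟨HodgeCM.CMField.K F⟩ ι₁ ⟨HodgeCM.HermSpace3.Hm V, HodgeCM.HermSpace3.isHermitian V, HodgeCM.HermSpace3.signature_ι₁ V, HodgeCM.HermSpace3.posDef_of_ne V⟩ Φ e₁ (frameD V) (frameD_real V) (frameD_ne V) (ιVE V) (2 * imagUnit (HodgeCM.CMField.K F))⁻¹ (fun _ _ => (Rep.update ↥(maximalRealSubfield (HodgeCM.CMField.K F)) (imagUnitSq (HodgeCM.CMField.K F)) (Rep.ofLineOf ↥(maximalRealSubfield (HodgeCM.CMField.K F)) (imagUnitSq (HodgeCM.CMField.K F))) (locF ↥(maximalRealSubfield (HodgeCM.CMField.K F)) (imagUnitSq (HodgeCM.CMField.K F)) (realUnit ⟨HodgeCM.CMField.K F⟩ a.1 a.2.1 a.2.2)) (realUnit ⟨HodgeCM.CMField.K F⟩ a.1 a.2.1 a.2.2) rfl))).omega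
            (galConj (IsCMField.complexConj _) ν) hν.galConj)
          ((uniformOmegaRep h ⟨HodgeCM.CMField.K F⟩ ι₁ ⟨HodgeCM.HermSpace3.Hm V, HodgeCM.HermSpace3.isHermitian V, HodgeCM.HermSpace3.signature_ι₁ V, HodgeCM.HermSpace3.posDef_of_ne V⟩ Φ e₁ (frameD V) (frameD_real V) (frameD_ne V) (ιVE V) (2 * imagUnit (HodgeCM.CMField.K F))⁻¹ (fun _ _ => (Rep.update ↥(maximalRealSubfield (HodgeCM.CMField.K F)) (imagUnitSq (HodgeCM.CMField.K F)) (Rep.ofLineOf ↥(maximalRealSubfield (HodgeCM.CMField.K F)) (imagUnitSq (HodgeCM.CMField.K F))) (locF ↥(maximalRealSubfield (HodgeCM.CMField.K F)) (imagUnitSq (HodgeCM.CMField.K F)) (realUnit ⟨HodgeCM.CMField.K F⟩ a.1 a.2.1 a.2.2)) (realUnit ⟨HodgeCM.CMField.K F⟩ a.1 a.2.1 a.2.2) rfl))).rho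
            (galConj (IsCMField.complexConj _) ν) hν.galConj)) :=
  toThm418Data_muConj_rest_eq_printed_hecke _ _ ν hν hw (AlgHom.id ℚ _) ι₁ _

set_option synthInstance.maxHeartbeats 400000 in
set_option maxHeartbeats 1600000 in
/-- **… line-keyed**: the same at the index line `i` of the pinned dictionary of record `(F, ι₁, V, a₀)` (`a := repAt a₀ i.fst`) — the LITERAL datum of
`hLiuC` in ✔ `ClosedPrintedMuConj` (p374084 :273–:277) ∕ its HomNeZero edition. [cite: Liu2021, Thm. 4.18 (FJcycle.tex ll. 2232–2245), Rem. 4.4, Def. 4.12] -/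
theorem toThm418Data_muConj_rest_eq_printed_ofRecordLine (F : HodgeCM.CMField) [IsGalois ℚ (F : Type)] (h6 : 6 ≤ Module.finrank ℚ (F : Type))
    {ι₁ : (F : Type) →+* ℂ} (V : HodgeCM.HermSpace3 F ι₁) (a₀ : RealScalar F) (h : exists_recordSystem) (Φ : CMType (F : Type))
    (i : I V (repAt a₀) (muLiu ι₁ GramClass.rep)) (ν : Literature.NumberTheory.Automorphic.IdeleClassGroup (F : Type) →ₜ* Circle)
    (hν : IdeleClassGroup.IsConjugateSymplectic (F : Type) ν) (hw : IdeleClassGroup.HasWeight (F : Type) ν 1) :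
    toThm418Data _ ((Summit.HodgeConjecture.CorCM.D2Bridge.AdapterMuConj.muConj (uniformOmegaRep h ⟨HodgeCM.CMField.K F⟩ ι₁ ⟨HodgeCM.HermSpace3.Hm V, HodgeCM.HermSpace3.isHermitian V, HodgeCM.HermSpace3.signature_ι₁ V, HodgeCM.HermSpace3.posDef_of_ne V⟩ Φ e₁ (frameD V) (frameD_real V) (frameD_ne V) (ιVE V) (2 * imagUnit (HodgeCM.CMField.K F))⁻¹ (fun _ _ => (Rep.update ↥(maximalRealSubfield (HodgeCM.CMField.K F)) (imagUnitSq (HodgeCM.CMField.K F)) (Rep.ofLineOf ↥(maximalRealSubfield (HodgeCM.CMField.K F)) (imagUnitSq (HodgeCM.CMField.K F))) (locF ↥(maximalRealSubfield (HodgeCM.CMField.K F)) (imagUnitSq (HodgeCM.CMField.K F)) (realUnit ⟨HodgeCM.CMField.K F⟩ (repAt a₀ (Sigma.fst i)).1 (repAt a₀ (Sigma.fst i)).2.1 (repAt a₀ (Sigma.fst i)).2.2)) (realUnit ⟨HodgeCM.CMField.K F⟩ (repAt a₀ (Sigma.fst i)).1 (repAt a₀ (Sigma.fst i)).2.1 (repAt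 a₀ (Sigma.fst i)).2.2) rfl)))).rest (restTailOne (AlgHom.id ℚ _) ι₁ hν hw (Def45.Carriers.ofPolDR ν (Def45.PolDR ι₁ hν (Def45.RMuForm ι₁ hν))) ((heckeTranslatesFamilyOf heckeTranslate_definedOver_holds h isoOf ⟨HodgeCM.CMField.K F⟩ ι₁ ⟨HodgeCM.HermSpace3.Hm V, HodgeCM.HermSpace3.isHermitian V, HodgeCM.HermSpace3.signature_ι₁ V, HodgeCM.HermSpace3.posDef_of_ne V⟩ Φ h6).rhoΩOne (AlgHom.id ℚ _) ι₁ hν hw (Def45.Carriers.ofPolDR ν (Def45.PolDR ι₁ hν (Def45.RMuForm ι₁ hν)))))) =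
      toThm418Data (sec42DataOf h isoOf ⟨HodgeCM.CMField.K F⟩ ι₁ ⟨HodgeCM.HermSpace3.Hm V, HodgeCM.HermSpace3.isHermitian V, HodgeCM.HermSpace3.signature_ι₁ V, HodgeCM.HermSpace3.posDef_of_ne V⟩ Φ)
        ((heckeTranslatesFamilyOf heckeTranslate_definedOver_holds h isoOf ⟨HodgeCM.CMField.K F⟩ ι₁ ⟨HodgeCM.HermSpace3.Hm V, HodgeCM.HermSpace3.isHermitian V, HodgeCM.HermSpace3.signature_ι₁ V, HodgeCM.HermSpace3.posDef_of_ne V⟩ Φ h6).restOne (AlgHom.id ℚ _) ι₁ hν hw (Def45.Carriers.ofPolDR ν (Def45.PolDR ι₁ hν (Def45.RMuForm ι₁ hν)))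
          (uniformOmegaRep h ⟨HodgeCM.CMField.K F⟩ ι₁ ⟨HodgeCM.HermSpace3.Hm V, HodgeCM.HermSpace3.isHermitian V, HodgeCM.HermSpace3.signature_ι₁ V, HodgeCM.HermSpace3.posDef_of_ne V⟩ Φ e₁ (frameD V) (frameD_real V) (frameD_ne V) (ιVE V) (2 * imagUnit (HodgeCM.CMField.K F))⁻¹ (fun _ _ => (Rep.update ↥(maximalRealSubfield (HodgeCM.CMField.K F)) (imagUnitSq (HodgeCM.CMField.K F)) (Rep.ofLineOf ↥(maximalRealSubfield (HodgeCM.CMField.K F)) (imagUnitSq (HodgeCM.CMField.K F))) (locF ↥(maximalRealSubfield (HodgeCM.CMField.K F)) (imagUnitSq (HodgeCM.CMField.K F)) (realUnit ⟨HodgeCM.CMField.K F⟩ (repAt a₀ (Sigma.fst i)).1 (repAt a₀ (Sigma.fst i)).2.1 (repAt a₀ (Sigma.fst i)).2.2)) (realUnit ⟨HodgeCM.CMField.K F⟩ (repAt a₀ (Sigma.fst i)).1 (repAt a₀ (Sigma.fst i)).2.1 (repAt a₀ (Sigma.fst i)).2.2) rfl))).Eps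
          (fun e => (uniformOmegaRep h ⟨HodgeCM.CMField.K F⟩ ι₁ ⟨HodgeCM.HermSpace3.Hm V, HodgeCM.HermSpace3.isHermitian V, HodgeCM.HermSpace3.signature_ι₁ V, HodgeCM.HermSpace3.posDef_of_ne V⟩ Φ e₁ (frameD V) (frameD_real V) (frameD_ne V) (ιVE V) (2 * imagUnit (HodgeCM.CMField.K F))⁻¹ (fun _ _ => (Rep.update ↥(maximalRealSubfield (HodgeCM.CMField.K F)) (imagUnitSq (HodgeCM.CMField.K F)) (Rep.ofLineOf ↥(maximalRealSubfield (HodgeCM.CMField.K F)) (imagUnitSq (HodgeCM.CMField.K F))) (locF ↥(maximalRealSubfield (HodgeCM.CMField.K F)) (imagUnitSq (HodgeCM.CMField.K F)) (realUnit ⟨HodgeCM.CMField.K F⟩ (repAt a₀ (Sigma.fst i)).1 (repAt a₀ (Sigma.fst i)).2.1 (repAt a₀ (Sigma.fst i)).2.2)) (realUnit ⟨HodgeCM.CMField.K F⟩ (repAt a₀ (Sigma.fst i)).1 (repAt a₀ (Sigma.fst i)).2.1 (repAt a₀ (Sigma.fst i)).2.2) rfl))).epsOf (-e))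
          (uniformOmegaRep h ⟨HodgeCM.CMField.K F⟩ ι₁ ⟨HodgeCM.HermSpace3.Hm V, HodgeCM.HermSpace3.isHermitian V, HodgeCM.HermSpace3.signature_ι₁ V, HodgeCM.HermSpace3.posDef_of_ne V⟩ Φ e₁ (frameD V) (frameD_real V) (frameD_ne V) (ιVE V) (2 * imagUnit (HodgeCM.CMField.K F))⁻¹ (fun _ _ => (Rep.update ↥(maximalRealSubfield (HodgeCM.CMField.K F)) (imagUnitSq (HodgeCM.CMField.K F)) (Rep.ofLineOf ↥(maximalRealSubfield (HodgeCM.CMField.K F)) (imagUnitSq (HodgeCM.CMField.K F))) (locF ↥(maximalRealSubfield (HodgeCM.CMField.K F)) (imagUnitSq (HodgeCM.CMField.K F)) (realUnit ⟨HodgeCM.CMField.K F⟩ (repAt a₀ (Sigma.fst i)).1 (repAt a₀ (Sigma.fst i)).2.1 (repAt a₀ (Sigma.fst i)).2.2)) (realUnit ⟨HodgeCM.CMField.K F⟩ (repAt a₀ (Sigma.fst i)).1 (repAt a₀ (Sigma.fst i)).2.1 (repAt a₀ (Sigma.fst i)).2.2) rfl))).Chi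
          ((uniformOmegaRep h ⟨HodgeCM.CMField.K F⟩ ι₁ ⟨HodgeCM.HermSpace3.Hm V, HodgeCM.HermSpace3.isHermitian V, HodgeCM.HermSpace3.signature_ι₁ V, HodgeCM.HermSpace3.posDef_of_ne V⟩ Φ e₁ (frameD V) (frameD_real V) (frameD_ne V) (ιVE V) (2 * imagUnit (HodgeCM.CMField.K F))⁻¹ (fun _ _ => (Rep.update ↥(maximalRealSubfield (HodgeCM.CMField.K F)) (imagUnitSq (HodgeCM.CMField.K F)) (Rep.ofLineOf ↥(maximalRealSubfield (HodgeCM.CMField.K F)) (imagUnitSq (HodgeCM.CMField.K F))) (locF ↥(maximalRealSubfield (HodgeCM.CMField.K F)) (imagUnitSq (HodgeCM.CMField.K F)) (realUnit ⟨HodgeCM.CMField.K F⟩ (repAt a₀ (Sigma.fst i)).1 (repAt a₀ (Sigma.fst i)).2.1 (repAt a₀ (Sigma.fst i)).2.2)) (realUnit ⟨HodgeCM.CMField.K F⟩ (repAt a₀ (Sigma.fst i)).1 (repAt a₀ (Sigma.fst i)).2.1 (repAt a₀ (Sigma.fst i)).2.2) rfl))).omega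
            (galConj (IsCMField.complexConj _) ν) hν.galConj)
          ((uniformOmegaRep h ⟨HodgeCM.CMField.K F⟩ ι₁ ⟨HodgeCM.HermSpace3.Hm V, HodgeCM.HermSpace3.isHermitian V, HodgeCM.HermSpace3.signature_ι₁ V, HodgeCM.HermSpace3.posDef_of_ne V⟩ Φ e₁ (frameD V) (frameD_real V) (frameD_ne V) (ιVE V) (2 * imagUnit (HodgeCM.CMField.K F))⁻¹ (fun _ _ => (Rep.update ↥(maximalRealSubfield (HodgeCM.CMField.K F)) (imagUnitSq (HodgeCM.CMField.K F)) (Rep.ofLineOf ↥(maximalRealSubfield (HodgeCM.CMField.K F)) (imagUnitSq (HodgeCM.CMField.K F))) (locF ↥(maximalRealSubfield (HodgeCM.CMField.K F)) (imagUnitSq (HodgeCM.CMField.K F)) (realUnit ⟨HodgeCM.CMField.K F⟩ (repAt a₀ (Sigma.fst i)).1 (repAt a₀ (Sigma.fst i)).2.1 (repAt a₀ (Sigma.fst i)).2.2)) (realUnit ⟨HodgeCM.CMField.K F⟩ (repAt a₀ (Sigma.fst i)).1 (repAt a₀ (Sigma.fst i)).2.1 (repAt a₀ (Sigma.fst i)).2.2)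 rfl))).rho
            (galConj (IsCMField.complexConj _) ν) hν.galConj)) :=
  toThm418Data_muConj_rest_eq_printed_ofRecord F h6 V (repAt a₀ (Sigma.fst i)) h Φ ν hν hw

end OfRecord

/-! ## §4 SPACE — kernel half of (e): the §4.2 datum's variety is the `c`-twist of the chosen canonical-model record -/

section Space

open CategoryTheory
open Literature.AlgebraicGeometry.Motives (baseChangeHom)
open Literature.AlgebraicGeometry.ShimuraVarieties.UnitaryCanonicalModel
open Summit.HodgeConjecture.CorCM.Model Summit.HodgeConjecture.CorCM.HComp

/-- **(e), kernel half: `ℭ.X_K = M_K ⊗_{F,c} F`** — for `4 ≤ [F:ℚ]` the variety `X_K = S̃h(𝕍)_K` of the §4.2 datum of record (`sec42DataOfFourLe h V Φ h4 iso`) is, ON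
THE NOSE as an `F`-scheme, the base change along the complex conjugation `c` of `F` of the CHOSEN canonical-model record `M_K := (recordOf h V h4).M.obj K` of
`Sh(Res_{F⁺/ℚ} U(V), h_{V,ῑ₁})_K` (✔ `sec42DataOfFourLe_X`, ✔ `conjSystem_obj`, ✔ `recordFunctorOf_eq`).  RIDER (desk ∕ print, d2bridge-ref G45 §0, d2bridge-stmt g3
cm2 l.12698): reading `M^{(c)}` as Liu's `X(𝕍^{(c)})` is transport of structure of the CONSTRUCTION along `c` — the tree holds no construction `X(·)` of Liu's
`Sh(𝕍)` and asserts no canonical-model uniqueness.  HC_CM is NOT proved. [cite: Liu2021, §4.2 (FJcycle.tex l. 2062), App. C Prop. C.5 (ll. 4627–4633), l. 4656]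
[cite: Deligne1979ShimuraVarieties, 2.2.5 and Cor. 2.7.21] -/
theorem X_sec42DataOfFourLe_eq_baseChange_complexConj_record (h : exists_recordSystem) {F : CMField} {ι₁ : F →+* ℂ}
    (V : HermSpace3 F ι₁) (Φ : Literature.AlgebraicGeometry.Motives.CMType F) (h4 : 4 ≤ Module.finrank ℚ F) (iso : ℕ → Prop)
    (K : C5.SmallLevel (K3 V)) :
    (sec42DataOfFourLe h V Φ h4 iso).X K = (baseChangeHom (cmConjRingHom F)).obj ((recordOf h V h4).M.obj K) := by
  show (baseChangeHom (cmConjRingHom F)).obj ((recordFunctorOf h V).obj K) = _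
  rw [recordFunctorOf_eq h V h4]

/-- **(e) at the literal §4.2 datum of record `ℭ := sec42DataOf h iso F ι₁ V Φ`** (`6 ≤ [F:ℚ]`, ✔ `sec42DataOf_eq_of_six_le`): at the level `ℭ.levelOf K` that
the END's `HomK K` reads (`toThm418Data` Glue :551, `HomK_eq`), `ℭ.X_{levelOf K} = M_{levelOf K} ⊗_{F,c} F` for the chosen canonical-model record — so the
END cites (e)'s kernel half with zero rewriting; the RIDER of the previous theorem applies verbatim.  HC_CM is NOT proved.
[cite: Liu2021, §4.2 (FJcycle.tex l. 2062), Thm. 4.18 (1) (l. 2239), App. C Prop. C.5 (ll. 4627–4633)] [cite: Deligne1979ShimuraVarieties, 2.2.5 and Cor. 2.7.21] -/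
theorem X_sec42DataOf_levelOf_eq_baseChange_complexConj_record (h : exists_recordSystem) {F : CMField} {ι₁ : F →+* ℂ}
    (V : HermSpace3 F ι₁) (Φ : Literature.AlgebraicGeometry.Motives.CMType F)
    (iso : ∀ (F : CMField) (ι₁ : F →+* ℂ) (_ : HermSpace3 F ι₁) (_ : Literature.AlgebraicGeometry.Motives.CMType F), ℕ → Prop)
    (h6 : 6 ≤ Module.finrank ℚ F) (K : Subgroup (honestP5Of h F ι₁ V Φ).G) :
    (sec42DataOf h iso F ι₁ V Φ).X ((sec42DataOf h iso F ι₁ V Φ).levelOf K) =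
      (baseChangeHom (cmConjRingHom F)).obj ((recordOf h V (le_trans (by norm_num) h6)).M.obj
        ((sec42DataOfFourLe h V Φ (le_trans (by norm_num) h6) (iso F ι₁ V Φ)).levelOf K)) := by
  rw [sec42DataOf_eq_of_six_le h V Φ iso h6]
  exact X_sec42DataOfFourLe_eq_baseChange_complexConj_record h V Φ _ (iso F ι₁ V Φ) _

end Space

end Summit.HodgeConjecture.CorCM.D2Bridge.MuConjIdent

end
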